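import Summits.Ventures.GridStability.Lyapunov.StructurePreservingRateDiam
import HarnessLib

/-!
# GridStability/Lyapunov/StructurePreservingRateDiamRoa — «SP-RATE» with the DIAMETER constant, along
# solutions: `V_h(t) ≤ V_h(0)e^{−vhRateD·t}` and `V(t) ≤ 3·vhGainD·V(0)·e^{−vhRateD·t}` on the certified
# region of record

Cell `gridfusion` (LADDER-GRIDFUSION), seat gridfusion-lyap-1 (g7), brief «SP-RATE»; sequel of
`StructurePreservingRateDiam.lean` (leaf Poincaré bound by path Cauchy–Schwarz, `vhRateD`, `vhGainD`,
`fderiv_vh_le_neg_vhRateD_mul`) — the same packaging as `StructurePreservingRateRoa.lean` (p545614) with the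
constant `4d·ΣD/β` (`d` = any bound on the coupling-graph distances) in place of `4n²·ΣD/β`:
* `vh_le_vhGainD_mul_phaseEnergy` — `V_h ≤ vhGainD·V` on the closed window ∩ leaf;
* **`vh_le_mul_exp_neg_of_sublevel_diam`**, **`phaseEnergy_le_mul_exp_neg_of_sublevel_diam`** — along every
  global solution from `S = {V ≤ c < c⋆(θ, β)} ∩ window ∩ leaf`: `V_h(X t) ≤ V_h(X 0)e^{−vhRateD·t}` and
  `V(X t) ≤ 3·vhGainD·V(X 0)·e^{−vhRateD·t}` (invariance of `S` by the theorem of record p475989, Khalil's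
  comparison step = lit-6's `Literature.Analysis.ODE.comp_le_mul_exp_neg_of_solution₀`).
THREE COLUMNS: mathematics about MODEL MV-3; `vhRateD` is a certified LOWER bound on the model's rate in
`S`; no certificate data; no sentence here says a grid is stable or well damped. No definition, no named
fact; standard axioms. [cite: Khalil2002, Theorem 4.10]
-/

noncomputable section

open Set Filter Topology Real Finset
open Summit.Ventures.GridStability.Models.StructurePreserving
open Summit.Ventures.GridStability.Models.StructurePreserving.Params
open Literature.MathematicalPhysics.PowerSystems (SinusoidalCoupling.sectorGain_pos)

namespace Summit.Ventures.GridStability.Lyapunov.StructurePreserving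

variable {n : ℕ}

/-! ### The gain comparison -/

/-- **`V_h ≤ vhGainD·V` on the closed window ∩ momentum leaf** (diameter form of
`vh_le_vhGain_mul_phaseEnergy`). [folklore] -/
theorem vh_le_vhGainD_mul_phaseEnergy {p : Params n} (hp : p.WellFormed) (hn : n ≠ 0)
    (hb : ∀ i j, 0 ≤ p.b i j) {β : ℝ} (hβ : 0 < β)
    (hβb : ∀ i j, p.couplingGraph.Adj i j → β ≤ p.b i j) {d : ℕ}
    (hdiam : ∀ i j : Fin n, ∃ w : p.couplingGraph.Walk i j, w.length ≤ d)
    {δ₀ : Fin n → ℝ} {θ : ℝ} (hθ0 : 0 ≤ θ) (hθ : θ < π / 2)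
    (h0 : ∀ i j, p.b i j ≠ 0 → |δ₀ i - δ₀ j| ≤ θ)
    {h : ℝ} (hh : 0 ≤ h) (hhM : ∀ i ∈ p.gen, 2 * h * p.M i ≤ p.D i)
    {x : (Fin n → ℝ) × (Fin n → ℝ)} (hx : x ∈ constraintSet p δ₀)
    (hP : ∀ i j, p.b i j ≠ 0 → |x.1 i - x.1 j| ≤ π / 2) :
    phaseEnergy p δ₀ x + h * crossTerm p δ₀ x ≤ vhGainD p β θ h d * phaseEnergy p δ₀ x := by
  set gθ := (1 - Real.sin θ) / (π / 2 - θ) with hgθ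
  set SD : ℝ := ∑ i, p.D i with hSD
  set SM : ℝ := ∑ i ∈ p.gen, p.M i with hSM
  set K : ℝ := p.kinetic x.2 with hK
  set Qx : ℝ := (1 / 2) * ∑ i, ∑ j, p.b i j * (((x.1 i - x.1 j) - (δ₀ i - δ₀ j)) ^ 2 / 2)
    with hQx
  set Φ : ℝ := ∑ i, p.D i * (x.1 i - δ₀ i) ^ 2 with hΦ
  set C := vhGainD p β θ h d with hC
  have hSDpos : 0 < SD := sum_D_pos hp hn
  have hSM0 : 0 ≤ SM := Finset.sum_nonneg fun i hi => (hp.M_pos i hi).le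
  have hg : 0 < gθ := SinusoidalCoupling.sectorGain_pos hθ0 hθ
  have hK0 : 0 ≤ K := p.kinetic_nonneg (fun i hi => (hp.M_pos i hi).le) x.2
  have hQ0 : 0 ≤ Qx := p.quadraticGap_nonneg hb δ₀ x.1
  have hd0 : 0 ≤ (d : ℝ) := Nat.cast_nonneg _
  have hup : phaseEnergy p δ₀ x + h * crossTerm p δ₀ x
      ≤ (2 + 2 * h * SM / SD) * K + (1 + 4 * h * (d : ℝ) * SD / β) * Qx := by
    have hA := vh_le_of_two_mul_le hp hb δ₀ hh hhM x
    have hB := sum_D_sq_le_of_diam hp hn hb hβ hβb hdiam hx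
    rw [← hK, ← hΦ, ← hQx] at hA
    rw [← hΦ, ← hQx, ← hSD, ← hSM] at hB
    have hB' := mul_le_mul_of_nonneg_left hB hh
    have : h * (4 * (d : ℝ) * SD / β * Qx + 2 * SM / SD * K)
        = (2 * h * SM / SD) * K + (4 * h * (d : ℝ) * SD / β) * Qx := by ring
    rw [this] at hB'
    linarith
  have hW : gθ * Qx ≤ p.potential δ₀ x.1 := p.potential_ge_quadratic hb hθ0 hθ h0 hP
  have hV : phaseEnergy p δ₀ x = K + p.potential δ₀ x.1 := rfl
  have hC1 : 2 + 2 * h * SM / SD ≤ C := by rw [hC]; unfold vhGainD; rw [← hSD, ← hSM]; exact le_max_left _ _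
  have hC2 : (1 + 4 * h * (d : ℝ) * SD / β) / gθ ≤ C := by
    rw [hC]; unfold vhGainD; rw [← hSD, ← hSM, ← hgθ]; exact le_max_right _ _
  have hC0 : 0 ≤ C := le_trans (by norm_num) (two_le_vhGainD hp hn hh (β := β) (θ := θ) d)
  have hQW : (1 + 4 * h * (d : ℝ) * SD / β) * Qx ≤ C * p.potential δ₀ x.1 := by
    have e : (1 + 4 * h * (d : ℝ) * SD / β) * Qx
        = ((1 + 4 * h * (d : ℝ) * SD / β) / gθ) * (gθ * Qx) := by
      field_simp
    rw [e]
    have hgQ0 : 0 ≤ gθ * Qx := mul_nonneg hg.le hQ0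
    calc (1 + 4 * h * (d : ℝ) * SD / β) / gθ * (gθ * Qx) ≤ C * (gθ * Qx) :=
          mul_le_mul_of_nonneg_right hC2 hgQ0
      _ ≤ C * p.potential δ₀ x.1 := mul_le_mul_of_nonneg_left hW hC0
  have hKC : (2 + 2 * h * SM / SD) * K ≤ C * K := mul_le_mul_of_nonneg_right hC1 hK0
  rw [hV, mul_add]
  linarith

/-! ### Exponential decay along solutions on the certified region of record -/

/-- **Exponential decay of `V_h` with the diameter rate** on the certified region of record
`S = {V ≤ c} ∩ window ∩ leaf` (`c < c⋆(θ, β)`): along EVERY global solution `X` of the phase field from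
`S`, for all `t ≥ 0`, `V_h(X t) ≤ V_h(X 0)·exp(−vhRateD·t)`. Data as in
`vh_le_mul_exp_neg_of_sublevel` plus the distance bound `hdiam`. MODEL MV-3; no sentence here says a grid
is stable or well damped. [cite: Khalil2002, Theorem 4.10 (proof)] -/
theorem vh_le_mul_exp_neg_of_sublevel_diam {p : Params n} (hp : p.WellFormed) (hn : n ≠ 0)
    (hconn : p.couplingGraph.Preconnected) (hb : ∀ i j, 0 ≤ p.b i j) {β : ℝ} (hβ : 0 < β)
    (hβb : ∀ i j, p.couplingGraph.Adj i j → β ≤ p.b i j) {d : ℕ}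
    (hdiam : ∀ i j : Fin n, ∃ w : p.couplingGraph.Walk i j, w.length ≤ d)
    {δ₀ : Fin n → ℝ} {θ : ℝ} (hθ0 : 0 ≤ θ) (hθ : θ < π / 2)
    (h0 : ∀ i j, p.b i j ≠ 0 → |δ₀ i - δ₀ j| ≤ θ) (hδ₀ : p.IsSyncEquilibrium δ₀)
    {c : ℝ} (hc : c < levelBound θ β) {h : ℝ} (hh : 0 < h)
    (hhM : ∀ i ∈ p.gen, 2 * h * p.M i ≤ p.D i)
    {X : ℝ → (Fin n → ℝ) × (Fin n → ℝ)}
    (hX0 : X 0 ∈ window p ∩ constraintSet p δ₀ ∧ phaseEnergy p δ₀ (X 0) ≤ c)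
    (hX : ∀ T : ℝ, ∀ t ∈ Icc 0 T, HasDerivWithinAt X (phaseField p (X t)) (Icc 0 T) t)
    {t : ℝ} (ht : 0 ≤ t) :
    phaseEnergy p δ₀ (X t) + h * crossTerm p δ₀ (X t)
      ≤ (phaseEnergy p δ₀ (X 0) + h * crossTerm p δ₀ (X 0)) * Real.exp (-vhRateD p β θ h d * t) := by
  obtain ⟨-, hall⟩ := sublevel_subset_regionOfAttraction hp hn hconn hb hβ hβb hθ0 hθ h0 hδ₀ hc hX0
  obtain ⟨hstay, -⟩ := hall X rfl hX
  have hcd : ContDiff ℝ 1 (fun y : (Fin n → ℝ) × (Fin n → ℝ) =>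
      phaseEnergy p δ₀ y + h * crossTerm p δ₀ y) :=
    (contDiff_phaseEnergy p δ₀).add (contDiff_const.mul (contDiff_crossTerm p δ₀))
  have hVd : ∀ s ∈ Icc 0 t, HasFDerivAt (fun y : (Fin n → ℝ) × (Fin n → ℝ) =>
      phaseEnergy p δ₀ y + h * crossTerm p δ₀ y)
      (fderiv ℝ (fun y : (Fin n → ℝ) × (Fin n → ℝ) => phaseEnergy p δ₀ y + h * crossTerm p δ₀ y)
        (X s)) (X s) :=
    fun s _ => ((hcd.differentiable one_ne_zero) (X s)).hasFDerivAt
  have hle : ∀ s ∈ Icc 0 t,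
      fderiv ℝ (fun y : (Fin n → ℝ) × (Fin n → ℝ) => phaseEnergy p δ₀ y + h * crossTerm p δ₀ y)
          (X s) (phaseField p (X s))
        ≤ -vhRateD p β θ h d * (phaseEnergy p δ₀ (X s) + h * crossTerm p δ₀ (X s)) := by
    intro s hs
    have hmem := hstay s hs.1
    exact fderiv_vh_le_neg_vhRateD_mul hp hn hb hβ hβb hdiam hθ0 hθ h0 hδ₀ hh hhM hmem.1.2
      (fun i j hij => (hmem.1.1 i j hij).le)
  exact Literature.Analysis.ODE.comp_le_mul_exp_neg_of_solution₀ (hX t) hVd hle ⟨ht, le_rfl⟩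

/-- **Exponential decay of the ENERGY OF RECORD with the diameter rate** on the certified region of
record: along EVERY global solution `X` from `S = {V ≤ c} ∩ window ∩ leaf` (`c < c⋆(θ, β)`), for all
`t ≥ 0`, `V(X t) ≤ 3·vhGainD·V(X 0)·exp(−vhRateD·t)`, with
`vhRateD = min{h/(1 + hΣ_gen M/ΣD), 2h·g(θ)/(1 + 4h·d·ΣD/β)}` — the «SP-RATE» sentence whose constant scales
with the DIAMETER bound `d` of the coupling graph instead of `n²`. MODEL MV-3; `vhRateD` is a certified lower
bound on the model's rate inside `S`; no sentence here says a grid is stable or well damped.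
[cite: Khalil2002, Theorem 4.10]; [cite: Padiyar2013, §3.2 eq (3.11)] -/
theorem phaseEnergy_le_mul_exp_neg_of_sublevel_diam {p : Params n} (hp : p.WellFormed) (hn : n ≠ 0)
    (hconn : p.couplingGraph.Preconnected) (hb : ∀ i j, 0 ≤ p.b i j) {β : ℝ} (hβ : 0 < β)
    (hβb : ∀ i j, p.couplingGraph.Adj i j → β ≤ p.b i j) {d : ℕ}
    (hdiam : ∀ i j : Fin n, ∃ w : p.couplingGraph.Walk i j, w.length ≤ d)
    {δ₀ : Fin n → ℝ} {θ : ℝ} (hθ0 : 0 ≤ θ) (hθ : θ < π / 2)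
    (h0 : ∀ i j, p.b i j ≠ 0 → |δ₀ i - δ₀ j| ≤ θ) (hδ₀ : p.IsSyncEquilibrium δ₀)
    {c : ℝ} (hc : c < levelBound θ β) {h : ℝ} (hh : 0 < h)
    (hhM : ∀ i ∈ p.gen, 2 * h * p.M i ≤ p.D i)
    {X : ℝ → (Fin n → ℝ) × (Fin n → ℝ)}
    (hX0 : X 0 ∈ window p ∩ constraintSet p δ₀ ∧ phaseEnergy p δ₀ (X 0) ≤ c)
    (hX : ∀ T : ℝ, ∀ t ∈ Icc 0 T, HasDerivWithinAt X (phaseField p (X t)) (Icc 0 T) t)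
    {t : ℝ} (ht : 0 ≤ t) :
    phaseEnergy p δ₀ (X t)
      ≤ 3 * vhGainD p β θ h d * phaseEnergy p δ₀ (X 0) * Real.exp (-vhRateD p β θ h d * t) := by
  obtain ⟨-, hall⟩ := sublevel_subset_regionOfAttraction hp hn hconn hb hβ hβb hθ0 hθ h0 hδ₀ hc hX0
  obtain ⟨hstay, -⟩ := hall X rfl hX
  have hdec := vh_le_mul_exp_neg_of_sublevel_diam hp hn hconn hb hβ hβb hdiam hθ0 hθ h0 hδ₀ hc hh
    hhM hX0 hX ht
  have h0' : ∀ i j, p.b i j ≠ 0 → |δ₀ i - δ₀ j| ≤ π / 2 := fun i j hij => (h0 i j hij).trans hθ.le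
  have hmem := hstay t ht
  have hP : ∀ i j, p.b i j ≠ 0 → |((X t).1 i - (X t).1 j) + (δ₀ i - δ₀ j)| ≤ π := by
    intro i j hij
    have h1 := abs_lt.1 (hmem.1.1 i j hij)
    have h2 := abs_le.1 (h0' i j hij)
    exact abs_le.2 ⟨by linarith [h1.1, h2.1], by linarith [h1.2, h2.2]⟩
  have h3 := phaseEnergy_le_three_mul_vh hp hb h0' hh.le hhM hP
  have hgain := vh_le_vhGainD_mul_phaseEnergy hp hn hb hβ hβb hdiam hθ0 hθ h0 hh.le hhM hX0.1.2
    (fun i j hij => (hX0.1.1 i j hij).le)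
  have hexp : 0 ≤ Real.exp (-vhRateD p β θ h d * t) := (Real.exp_pos _).le
  calc phaseEnergy p δ₀ (X t)
      ≤ 3 * (phaseEnergy p δ₀ (X t) + h * crossTerm p δ₀ (X t)) := h3
    _ ≤ 3 * ((phaseEnergy p δ₀ (X 0) + h * crossTerm p δ₀ (X 0))
          * Real.exp (-vhRateD p β θ h d * t)) := by linarith
    _ ≤ 3 * ((vhGainD p β θ h d * phaseEnergy p δ₀ (X 0)) * Real.exp (-vhRateD p β θ h d * t)) := by
        have := mul_le_mul_of_nonneg_right hgain hexp
        linarith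
    _ = 3 * vhGainD p β θ h d * phaseEnergy p δ₀ (X 0) * Real.exp (-vhRateD p β θ h d * t) := by
        ring

/-! ### A diameter bound from a rooted spanning structure (for instances) -/

/-- **Walks to the root from a parent array with strictly decreasing depth**: if every non-root vertex
`v` is adjacent to `parent v` with `depth (parent v) < depth v`, then every vertex `v` is joined to the
root by a walk of length `≤ depth v`. [folklore] -/
theorem exists_walk_root_length_le {G : SimpleGraph (Fin n)} (root : Fin n) (parent : Fin n → Fin n)
    (depth : Fin n → ℕ) (hadj : ∀ v, v ≠ root → G.Adj v (parent v))
    (hdepth : ∀ v, v ≠ root → depth (parent v) < depth v) :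
    ∀ v, ∃ w : G.Walk v root, w.length ≤ depth v := by
  suffices h : ∀ k : ℕ, ∀ v, depth v ≤ k → ∃ w : G.Walk v root, w.length ≤ depth v from
    fun v => h (depth v) v le_rfl
  intro k
  induction k with
  | zero =>
    intro v hv
    by_cases hvr : v = root
    · subst hvr
      exact ⟨SimpleGraph.Walk.nil, by simp⟩
    · exact absurd (hdepth v hvr) (by omega)
  | succ k ih =>
    intro v hv
    by_cases hvr : v = root
    · subst hvr
      exact ⟨SimpleGraph.Walk.nil, by simp⟩
    · have hlt := hdepth v hvr
      obtain ⟨w, hw⟩ := ih (parent v) (by omega)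
      exact ⟨SimpleGraph.Walk.cons (hadj v hvr) w, by simp only [SimpleGraph.Walk.length_cons]; omega⟩

/-- **Diameter bound `2e` from a rooted spanning structure of depth `≤ e`**: every two vertices are joined
by a walk of length `≤ 2e` (to the root and back). [folklore] -/
theorem exists_walk_length_le_of_parent {G : SimpleGraph (Fin n)} (root : Fin n) (parent : Fin n → Fin n)
    (depth : Fin n → ℕ) (hadj : ∀ v, v ≠ root → G.Adj v (parent v))
    (hdepth : ∀ v, v ≠ root → depth (parent v) < depth v) {e : ℕ} (he : ∀ v, depth v ≤ e) :
    ∀ i j, ∃ w : G.Walk i j, w.length ≤ 2 * e := by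
  intro i j
  obtain ⟨wi, hwi⟩ := exists_walk_root_length_le root parent depth hadj hdepth i
  obtain ⟨wj, hwj⟩ := exists_walk_root_length_le root parent depth hadj hdepth j
  refine ⟨wi.append wj.reverse, ?_⟩
  rw [SimpleGraph.Walk.length_append, SimpleGraph.Walk.length_reverse]
  have := he i
  have := he j
  omega

end Summit.Ventures.GridStability.Lyapunov.StructurePreserving

end
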